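import Summits.CriticalPhenomena.Ising3DConformalLimit.Theses.LongRangeEndpoint
import HarnessLib

/-!
# Crux `EndpointContinuity` (stmt-CriticalPhenomena-11274) — typed three-leaf split (glue)

THEOREM-ONLY glue for
`ledger route edit route-CriticalPhenomena-LongRangeEndpoint --split EndpointContinuity --glue-by
Summit.CriticalPhenomena.Ising3DConformalLimit.LongRangeEndpointEndpointContinuitySplit.endpointContinuity_of_subs`,
authored by the crux-strategist seat `planner-cstrat-stmt-CriticalPhenomena-11274-r1-0` (2026-08-17; route
re-audit bin RESTATED → BC2 redirect exemption).

The crux says: with `αs` the least upper bound of the protected-window set and `3/2 < αs`, every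
normalised family `S` of pointwise scaling limits of the critical `J_α`-correlators on the window
`(3/2, αs)` converges pointwise as `α ↑ αs` to an endpoint family `T` with `T₂ > 0` and `U₄(T) ≢ 0`.
The three leaves never mention `T`; they are UNIFORM STATEMENTS ABOUT THE LONG-RANGE FAMILY INSIDE
THE WINDOW, on a left neighbourhood `(αs − ε, αs)` of the crossover:

* `EndpointModulus` — Hölder continuity in the exponent: `|S α n z − S α' n z| ≤ C |α − α'|^θ`
  (every `n`, every configuration `z`; quantitative BRRZ continuity, arXiv:1703.05325 §4.3.1);
* `EndpointTwoPointFloor` — `c ≤ S α 2 x` for each non-coincident pair `x` (similarity covariance with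
  the protected `Δ(α) = (3−α)/2` pins `S α 2 x = ‖x₀−x₁‖^(α−3)`);
* `EndpointU4Floor` — `c ≤ |U₄(S α)(x)|` at one non-coincident quadruple `x` (the interaction does
  not switch off at the crossover: Sak endpoint, not Fisher–Ma–Nickel).

`endpointContinuity_of_subs : EndpointModulus → EndpointTwoPointFloor → EndpointU4Floor →
EndpointContinuity` (shape `C₁ → C₂ → C₃ → C`, leaves spelled out verbatim as the let-headed terms the
gate renders). The content sits in `core`: the endpoint family `T` is CONSTRUCTED from the modulus by
the Cauchy criterion in `ℝ` (`exists_tendsto_of_modulus`, `cauchy_map_iff_exists_tendsto`), and its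
non-degeneracy / non-Gaussianity are obtained by passing the uniform pre-limit floors through the limit
(`ge_of_tendsto`, continuity of the Ursell polynomial). `floors_of_endpoint` certifies that leaves 2–3
are implied by the crux's conclusion. No `def`s; axioms `propext`, `Classical.choice`, `Quot.sound`.
-/

noncomputable section

namespace Summit.CriticalPhenomena.Ising3DConformalLimit.LongRangeEndpointEndpointContinuitySplit

open scoped BigOperators Topology Classical
open Filter Set
open Literature.Probability.LatticeModels



/-- A Hölder-type modulus of continuity on a left neighbourhood of `αs` forces the left limit at
`αs` to exist (Cauchy criterion in the complete space `ℝ`). [folklore] -/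
theorem exists_tendsto_of_modulus {αs : ℝ} {f : ℝ → ℝ}
    (h : ∃ ε : ℝ, 0 < ε ∧ ∃ C θ : ℝ, 0 < θ ∧ ∀ a ∈ Set.Ioo (αs - ε) αs, ∀ a' ∈ Set.Ioo (αs - ε) αs,
      |f a - f a'| ≤ C * |a - a'| ^ θ) :
    ∃ t : ℝ, Tendsto f (𝓝[<] αs) (𝓝 t) := by
  obtain ⟨ε, hε, C, θ, hθ, hmod⟩ := h
  rw [← cauchy_map_iff_exists_tendsto]
  refine Metric.cauchy_iff.2 ⟨Filter.map_neBot, fun e he => ?_⟩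
  -- the effective constant `C' = max C 0 ≥ 0`
  set C' : ℝ := max C 0 with hC'
  have hC'0 : 0 ≤ C' := le_max_right _ _
  have hCC' : C ≤ C' := le_max_left _ _
  -- choose `η₀ > 0` with `C' * η₀ ^ θ < e`
  set q : ℝ := e / (2 * (C' + 1)) with hq
  have hq0 : 0 < q := by
    have : 0 < 2 * (C' + 1) := by positivity
    exact div_pos he this
  set η₀ : ℝ := q ^ θ⁻¹ with hη₀
  have hη₀0 : 0 < η₀ := Real.rpow_pos_of_pos hq0 _
  have hη₀θ : η₀ ^ θ = q := by
    rw [hη₀, Real.rpow_inv_rpow hq0.le hθ.ne']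
  have hsmall : C' * η₀ ^ θ < e := by
    rw [hη₀θ, hq]
    have h1 : C' * (e / (2 * (C' + 1))) = e * (C' / (2 * (C' + 1))) := by ring
    rw [h1]
    have h2 : C' / (2 * (C' + 1)) < 1 := by
      rw [div_lt_one (by positivity)]
      linarith
    calc e * (C' / (2 * (C' + 1))) < e * 1 := by
          exact mul_lt_mul_of_pos_left h2 he
      _ = e := mul_one e
  -- the set `f '' Ioo (αs - η) αs` belongs to the mapped filter and has diameter `< e`
  set η : ℝ := min ε η₀ with hη
  have hη0 : 0 < η := lt_min hε hη₀0
  have hηε : η ≤ ε := min_le_left _ _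
  have hηη₀ : η ≤ η₀ := min_le_right _ _
  refine ⟨f '' Set.Ioo (αs - η) αs, image_mem_map (Ioo_mem_nhdsLT (by linarith)), ?_⟩
  rintro x ⟨a, ha, rfl⟩ y ⟨a', ha', rfl⟩
  have haε : a ∈ Set.Ioo (αs - ε) αs := ⟨by linarith [ha.1], ha.2⟩
  have ha'ε : a' ∈ Set.Ioo (αs - ε) αs := ⟨by linarith [ha'.1], ha'.2⟩
  have hdist : |a - a'| ≤ η₀ := by
    rw [abs_sub_le_iff]
    constructor <;> linarith [ha.1, ha.2, ha'.1, ha'.2]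
  have hpow : |a - a'| ^ θ ≤ η₀ ^ θ :=
    Real.rpow_le_rpow (abs_nonneg _) hdist hθ.le
  have hpow0 : 0 ≤ |a - a'| ^ θ := Real.rpow_nonneg (abs_nonneg _) _
  rw [Real.dist_eq]
  calc |f a - f a'| ≤ C * |a - a'| ^ θ := hmod a haε a' ha'ε
    _ ≤ C' * |a - a'| ^ θ := mul_le_mul_of_nonneg_right hCC' hpow0
    _ ≤ C' * η₀ ^ θ := mul_le_mul_of_nonneg_left hpow hC'0
    _ < e := hsmall

/-- **Core of the split.** For a one-parameter family `S : ℝ → CorrFamily 3` and an endpoint `αs`: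
a Hölder modulus in the parameter on a left neighbourhood of `αs` (every `n`, every configuration),
a two-point floor near `αs` on non-coincident pairs, and a floor for `|U₄|` near `αs` at one
non-coincident quadruple together produce an endpoint family `T` — the pointwise left limit —
which is non-degenerate and non-Gaussian. `T` is CONSTRUCTED here (completeness of `ℝ`), and its
two properties are obtained by passing the uniform pre-limit bounds through the limit
(`ge_of_tendsto`, continuity of the Ursell polynomial `limitConnectedFour`). [folklore] -/
theorem core {αs : ℝ} {S : ℝ → CorrFamily 3}
    (h1 : ∀ (n : ℕ) (z : Fin n → EuclideanSpace ℝ (Fin 3)), ∃ ε : ℝ, 0 < ε ∧ ∃ C θ : ℝ, 0 < θ ∧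
      ∀ a ∈ Set.Ioo (αs - ε) αs, ∀ a' ∈ Set.Ioo (αs - ε) αs, |S a n z - S a' n z| ≤ C * |a - a'| ^ θ)
    (h2 : ∀ x ∈ NonCoincident 3 2, ∃ c : ℝ, 0 < c ∧ ∃ ε : ℝ, 0 < ε ∧
      ∀ a ∈ Set.Ioo (αs - ε) αs, c ≤ S a 2 x)
    (h3 : ∃ x ∈ NonCoincident 3 4, ∃ c : ℝ, 0 < c ∧ ∃ ε : ℝ, 0 < ε ∧
      ∀ a ∈ Set.Ioo (αs - ε) αs, c ≤ |limitConnectedFour (S a) x|) :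
    ∃ T : CorrFamily 3,
      (∀ (n : ℕ) (z : Fin n → EuclideanSpace ℝ (Fin 3)),
        Filter.Tendsto (fun a : ℝ => S a n z) (𝓝[<] αs) (𝓝 (T n z))) ∧
      IsNondegenerateTwoPoint T ∧ HasNontrivialU4 T := by
  -- (1) the endpoint family, configuration by configuration, from the modulus
  choose T hT using fun (n : ℕ) (z : Fin n → EuclideanSpace ℝ (Fin 3)) =>
    exists_tendsto_of_modulus (h1 n z)
  refine ⟨T, hT, ?_, ?_⟩
  · -- (2) non-degeneracy: the uniform two-point floor survives the limit
    intro x hx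
    obtain ⟨c, hc, ε, hε, hfloor⟩ := h2 x hx
    have hev : ∀ᶠ a in 𝓝[<] αs, c ≤ S a 2 x :=
      mem_of_superset (Ioo_mem_nhdsLT (by linarith)) fun a ha => hfloor a ha
    exact lt_of_lt_of_le hc (ge_of_tendsto (hT 2 x) hev)
  · -- (3) non-Gaussianity: `U₄(S a) x → U₄(T) x` and the floor on `|U₄|` survives the limit
    obtain ⟨x, hx, c, hc, ε, hε, hfloor⟩ := h3
    refine ⟨x, hx, ?_⟩
    have hlim : Filter.Tendsto (fun a : ℝ => limitConnectedFour (S a) x) (𝓝[<] αs)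
        (𝓝 (limitConnectedFour T x)) := by
      unfold limitConnectedFour
      exact (hT 4 x).sub ((((hT 2 _).mul (hT 2 _)).add ((hT 2 _).mul (hT 2 _))).add
        ((hT 2 _).mul (hT 2 _)))
    have hev : ∀ᶠ a in 𝓝[<] αs, c ≤ |limitConnectedFour (S a) x| :=
      mem_of_superset (Ioo_mem_nhdsLT (by linarith)) fun a ha => hfloor a ha
    have habs : c ≤ |limitConnectedFour T x| :=
      ge_of_tendsto ((continuous_abs.tendsto _).comp hlim) hev
    intro h0
    rw [h0, abs_zero] at habs
    exact absurd habs (not_le.mpr hc)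


/-- **Tightness of leaves 2 and 3.** Conversely, if the endpoint family exists pointwise and is
non-degenerate and non-Gaussian, then the two-point floor and the `|U₄|` floor near `αs` hold:
these two leaves are CONSEQUENCES of the crux's conclusion (the split loses nothing there); only
the modulus leaf is deliberately quantitative (stronger than bare convergence). [folklore] -/
theorem floors_of_endpoint {αs : ℝ} {S : ℝ → CorrFamily 3} {T : CorrFamily 3}
    (hT : ∀ (n : ℕ) (z : Fin n → EuclideanSpace ℝ (Fin 3)),
      Filter.Tendsto (fun a : ℝ => S a n z) (𝓝[<] αs) (𝓝 (T n z)))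
    (hnd : IsNondegenerateTwoPoint T) (hU4 : HasNontrivialU4 T) :
    (∀ x ∈ NonCoincident 3 2, ∃ c : ℝ, 0 < c ∧ ∃ ε : ℝ, 0 < ε ∧
      ∀ a ∈ Set.Ioo (αs - ε) αs, c ≤ S a 2 x) ∧
    (∃ x ∈ NonCoincident 3 4, ∃ c : ℝ, 0 < c ∧ ∃ ε : ℝ, 0 < ε ∧
      ∀ a ∈ Set.Ioo (αs - ε) αs, c ≤ |limitConnectedFour (S a) x|) := by
  constructor
  · intro x hx
    have hpos : 0 < T 2 x := hnd x hx
    have hev : ∀ᶠ a in 𝓝[<] αs, T 2 x / 2 < S a 2 x :=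
      (hT 2 x).eventually (lt_mem_nhds (by linarith))
    obtain ⟨l, hl, hsub⟩ := mem_nhdsLT_iff_exists_Ioo_subset.1 hev
    refine ⟨T 2 x / 2, by linarith, αs - l, by simpa using hl, fun a ha => ?_⟩
    have ha' : a ∈ Set.Ioo l αs := ⟨by linarith [ha.1], ha.2⟩
    exact le_of_lt (hsub ha')
  · obtain ⟨x, hx, hne⟩ := hU4
    have hlim : Filter.Tendsto (fun a : ℝ => limitConnectedFour (S a) x) (𝓝[<] αs)
        (𝓝 (limitConnectedFour T x)) := by
      unfold limitConnectedFour
      exact (hT 4 x).sub ((((hT 2 _).mul (hT 2 _)).add ((hT 2 _).mul (hT 2 _))).add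
        ((hT 2 _).mul (hT 2 _)))
    have hpos : 0 < |limitConnectedFour T x| := abs_pos.2 hne
    have hev : ∀ᶠ a in 𝓝[<] αs, |limitConnectedFour T x| / 2 < |limitConnectedFour (S a) x| :=
      ((continuous_abs.tendsto _).comp hlim).eventually (lt_mem_nhds (by linarith))
    obtain ⟨l, hl, hsub⟩ := mem_nhdsLT_iff_exists_Ioo_subset.1 hev
    refine ⟨x, hx, |limitConnectedFour T x| / 2, by linarith, αs - l, by simpa using hl,
      fun a ha => ?_⟩
    have ha' : a ∈ Set.Ioo l αs := ⟨by linarith [ha.1], ha.2⟩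
    exact le_of_lt (hsub ha')

/-- **Glue of the three-leaf split** `EndpointModulus → EndpointTwoPointFloor → EndpointU4Floor →
EndpointContinuity` (leaves verbatim, in this order): thread the shared data (`αs`, its `IsLUB`
property, `3/2 < αs`, the normalised family `S` with its hypothesis) into the three leaves and run
`core`. [folklore] -/
theorem endpointContinuity_of_subs :
    (open Literature.Probability.LatticeModels in let J : ℝ → Site 3 → Site 3 → ℝ := fun a x y => if x = y then (0 : ℝ) else -(((2 * Real.pi) ^ 3)⁻¹ * ∫ k in Set.pi Set.univ (fun _ : Fin 3 => Set.Icc (-Real.pi) Real.pi), (2 * ∑ i, (1 - Real.cos (k i))) ^ (a / 2) * Real.cos (∑ j, k j * ((x j : ℝ) - (y j : ℝ)))); let st : ℝ → ℝ → ℝ → (SpinConfig (Site 3) → ℝ) → ℝ := fun a β h F => limUnder atTop (fun L : ℕ => let Λ := box 3 L; let w : (↥Λ → ℤˣ) → ℝ := fun τ => Real.exp (-β * (-(∑ x ∈ Λ, ∑ y ∈ Λ, J a x y * spinAt x (glue Λ τ .free) * spinAt y (glue Λ τ .free)) / 2 - h * ∑ x ∈ Λ, spinAt x (glue Λ τ .free)));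 (∑ τ, F (glue Λ τ .free) * w τ) / ∑ τ, w τ); let βc : ℝ → ℝ := fun a => sInf {β : ℝ | 0 < β ∧ 0 < limUnder (𝓝[>] (0 : ℝ)) (fun h : ℝ => st a β h (spinAt 0))}; let G : ℝ → Site 3 → ℝ := fun a x => st a (βc a) 0 (fun σ => spinAt 0 σ * spinAt x σ); let corr : ℝ → (n : ℕ) → (Fin n → Site 3) → ℝ := fun a _ y => st a (βc a) 0 (spinMonomial y); let Prot : ℝ → Prop := fun b => ∃ c C : ℝ, 0 < c ∧ ∀ x : Site 3, x ≠ 0 → c / ‖x‖ ^ ((3 : ℝ) - b) ≤ G b x ∧ G b x ≤ C / ‖x‖ ^ ((3 : ℝ) - b); ∀ αs : ℝ, IsLUB {a : ℝ | a ≤ 2 ∧ ∀ b ∈ Set.Ioo (3 / 2 : ℝ) a, Prot b} αs → 3 / 2 < αs → ∀ S : ℝ → CorrFamily 3, (∀ a ∈ Set.Ioo (3 / 2 : ℝ) αs, (∃ ρ : ℝ → ℝ, (∀ δ ∈ Set.Ioc (0 : ℝ) 1, 0 < ρ δ) ∧ HasPointwiseScalingLimit (corr a) ρ (S a)) ∧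 S a 2 ![0, (EuclideanSpace.single (0 : Fin 3) (1 : ℝ))] = 1 ∧ (∀ (n : ℕ) (z : Fin n → EuclideanSpace ℝ (Fin 3)), z ∉ NonCoincident 3 n → S a n z = 0)) → ∀ (n : ℕ) (z : Fin n → EuclideanSpace ℝ (Fin 3)), ∃ ε : ℝ, 0 < ε ∧ ∃ C θ : ℝ, 0 < θ ∧ ∀ a ∈ Set.Ioo (αs - ε) αs, ∀ a' ∈ Set.Ioo (αs - ε) αs, |S a n z - S a' n z| ≤ C * |a - a'| ^ θ) →
    (open Literature.Probability.LatticeModels in let J : ℝ → Site 3 → Site 3 → ℝ := fun a x y => if x = y then (0 : ℝ) else -(((2 * Real.pi) ^ 3)⁻¹ * ∫ k in Set.pi Set.univ (fun _ : Fin 3 => Set.Icc (-Real.pi) Real.pi), (2 * ∑ i, (1 - Real.cos (k i))) ^ (a / 2) * Real.cos (∑ j, k j * ((x j : ℝ) - (y j : ℝ)))); let st : ℝ → ℝ → ℝ → (SpinConfig (Site 3) → ℝ) → ℝ := fun a β h F => limUnder atTop (fun L : ℕ => let Λ := box 3 L; let w : (↥Λ → ℤˣ) → ℝ := fun τ =>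 Real.exp (-β * (-(∑ x ∈ Λ, ∑ y ∈ Λ, J a x y * spinAt x (glue Λ τ .free) * spinAt y (glue Λ τ .free)) / 2 - h * ∑ x ∈ Λ, spinAt x (glue Λ τ .free))); (∑ τ, F (glue Λ τ .free) * w τ) / ∑ τ, w τ); let βc : ℝ → ℝ := fun a => sInf {β : ℝ | 0 < β ∧ 0 < limUnder (𝓝[>] (0 : ℝ)) (fun h : ℝ => st a β h (spinAt 0))}; let G : ℝ → Site 3 → ℝ := fun a x => st a (βc a) 0 (fun σ => spinAt 0 σ * spinAt x σ); let corr : ℝ → (n : ℕ) → (Fin n → Site 3) → ℝ := fun a _ y => st a (βc a) 0 (spinMonomial y); let Prot : ℝ → Prop := fun b => ∃ c C : ℝ, 0 < c ∧ ∀ x : Site 3, x ≠ 0 → c / ‖x‖ ^ ((3 : ℝ) - b) ≤ G b x ∧ G b x ≤ C / ‖x‖ ^ ((3 : ℝ) - b); ∀ αs : ℝ, IsLUB {a : ℝ | a ≤ 2 ∧ ∀ b ∈ Set.Ioo (3 / 2 : ℝ) a, Prot b} αs → 3 / 2 < αs → ∀ S : ℝ → CorrFamily 3, (∀ a ∈ Set.Ioo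 (3 / 2 : ℝ) αs, (∃ ρ : ℝ → ℝ, (∀ δ ∈ Set.Ioc (0 : ℝ) 1, 0 < ρ δ) ∧ HasPointwiseScalingLimit (corr a) ρ (S a)) ∧ S a 2 ![0, (EuclideanSpace.single (0 : Fin 3) (1 : ℝ))] = 1 ∧ (∀ (n : ℕ) (z : Fin n → EuclideanSpace ℝ (Fin 3)), z ∉ NonCoincident 3 n → S a n z = 0)) → ∀ x ∈ NonCoincident 3 2, ∃ c : ℝ, 0 < c ∧ ∃ ε : ℝ, 0 < ε ∧ ∀ a ∈ Set.Ioo (αs - ε) αs, c ≤ S a 2 x) →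
    (open Literature.Probability.LatticeModels in let J : ℝ → Site 3 → Site 3 → ℝ := fun a x y => if x = y then (0 : ℝ) else -(((2 * Real.pi) ^ 3)⁻¹ * ∫ k in Set.pi Set.univ (fun _ : Fin 3 => Set.Icc (-Real.pi) Real.pi), (2 * ∑ i, (1 - Real.cos (k i))) ^ (a / 2) * Real.cos (∑ j, k j * ((x j : ℝ) - (y j : ℝ)))); let st : ℝ → ℝ → ℝ → (SpinConfig (Site 3) → ℝ) → ℝ := fun a β h F => limUnder atTop (fun L : ℕ => let Λ := box 3 L; let w : (↥Λ → ℤˣ) → ℝ := fun τ => Real.exp (-β * (-(∑ x ∈ Λ, ∑ y ∈ Λ, J a x y * spinAt x (glue Λ τ .free) * spinAt y (glue Λ τ .free)) / 2 - h * ∑ x ∈ Λ, spinAt x (glue Λ τ .free))); (∑ τ, F (glue Λ τ .free) * w τ) / ∑ τ, w τ); let βc : ℝ → ℝ := fun a => sInf {β : ℝ | 0 < β ∧ 0 < limUnder (𝓝[>] (0 : ℝ)) (fun h : ℝ => st a β h (spinAt 0))}; let G : ℝ → Site 3 → ℝ := fun a x => st a (βc a) 0 (fun σ => spinAt 0 σ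 * spinAt x σ); let corr : ℝ → (n : ℕ) → (Fin n → Site 3) → ℝ := fun a _ y => st a (βc a) 0 (spinMonomial y); let Prot : ℝ → Prop := fun b => ∃ c C : ℝ, 0 < c ∧ ∀ x : Site 3, x ≠ 0 → c / ‖x‖ ^ ((3 : ℝ) - b) ≤ G b x ∧ G b x ≤ C / ‖x‖ ^ ((3 : ℝ) - b); ∀ αs : ℝ, IsLUB {a : ℝ | a ≤ 2 ∧ ∀ b ∈ Set.Ioo (3 / 2 : ℝ) a, Prot b} αs → 3 / 2 < αs → ∀ S : ℝ → CorrFamily 3, (∀ a ∈ Set.Ioo (3 / 2 : ℝ) αs, (∃ ρ : ℝ → ℝ, (∀ δ ∈ Set.Ioc (0 : ℝ) 1, 0 < ρ δ) ∧ HasPointwiseScalingLimit (corr a) ρ (S a)) ∧ S a 2 ![0, (EuclideanSpace.single (0 : Fin 3) (1 : ℝ))] = 1 ∧ (∀ (n : ℕ) (z : Fin n → EuclideanSpace ℝ (Fin 3)), z ∉ NonCoincident 3 n → S a n z = 0)) → ∃ x ∈ NonCoincident 3 4, ∃ c : ℝ, 0 < c ∧ ∃ ε : ℝ, 0 < ε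 ∧ ∀ a ∈ Set.Ioo (αs - ε) αs, c ≤ |limitConnectedFour (S a) x|) →
    Summit.CriticalPhenomena.Ising3DConformalLimit.Theses.LongRangeEndpoint.EndpointContinuity := by
  intro h1 h2 h3 αs hlub hαs S hS
  exact core (h1 αs hlub hαs S hS) (h2 αs hlub hαs S hS) (h3 αs hlub hαs S hS)

end Summit.CriticalPhenomena.Ising3DConformalLimit.LongRangeEndpointEndpointContinuitySplit
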